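import Literature.NumberTheory.Automorphic.PretraceApproxIdentity
import Literature.NumberTheory.Automorphic.SpectralTestFunctions
import Literature.NumberTheory.Automorphic.CuspFormsCompact

/-!
# The tent kernel: a Lipschitz minorant of the ball kernel with `|h(t)| ≥ πδ` for `|s| ≤ (32√δ)⁻¹`
(Iwaniec, *Spectral Methods of Automorphic Forms*, GSM 53, proof of Proposition 7.2 (local Weyl
law (7.10): the kernel `𝟙_{[0,δ]}`, "`2πδ < |h(t)| < 6πδ` if `|s| ≤ (8√δ)⁻¹`",
`∫_F |K(z,w)|² dμ z ≤ N_δ(w) h(i/2)`), PDF p. 73)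

A brick of the Eisenstein-free proof of the pretrace estimate (12.5)
(`Literature.NumberTheory.Automorphic.Iwaniec2002_eq_12_5`). The operators entering that proof
must have *continuous (Lipschitz)* kernels (`kernelCLM`, compactness of `T_k Λ`), so the ball
kernel `𝟙_{[0,δ]}` of Proposition 7.2 is replaced by the tent `k_δ(u) = max(0, 1 - |u|/δ)` of
`CuspFormsCompact` (`tentKernel`), `0 ≤ k_δ ≤ 𝟙_{[0,δ]}`, for which the two estimates of the proof of
Proposition 7.2 persist:

1. (§1) `k_δ` is a Lipschitz test kernel, `∫_0^∞ k_δ = δ/2`, and **`πδ ≤ |h_δ(t)|`** for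
   `‖½ + it‖ · 32√δ ≤ 1` (`norm_selbergTransform_tentKernel_ge`; Iwaniec's argument verbatim:
   `|y^s - 1| ≤ ½` on the ball, so `|h(t) - ∫ k_δ dμ| ≤ ½ ∫ k_δ dμ = πδ`); for real `t`, `h_δ(t)` is
   real, so `h_δ(t)² ≥ π²δ²` (`sq_selbergTransform_tentKernel_ge`).
2. (§2) `0 ≤ K_δ^{tent} ≤ K_δ^{ball}` pointwise, whence **`∫_F K_δ^{tent}(·, w)² ≤ 2 N_δ(w) · 4πδ`**
   (`lintegral_automorphicKernel_tentKernel_sq_le`, from `lintegral_automorphicKernel_sq_le`).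
3. (§3) the orbit count `N_δ(w)` is bounded for `δ ≤ 1` and `w` in the unit ball about `w₀`
   (`orbitCount_le_near`), the local uniformity needed when `w` runs over the support of an
   approximate identity at `w₀`.

Everything here is proved; nothing is vendored; no fact is introduced.

## References
* [Iwaniec2002] H. Iwaniec, *Spectral Methods of Automorphic Forms*, 2nd ed., GSM 53, AMS 2002,
  proof of Prop. 7.2, PDF p. 73 (held copy `book:iwaniec2002-spectral-methods-automorphic-forms`).
-/

noncomputable section

namespace Literature.NumberTheory.Automorphic

open _root_.MeasureTheory _root_.Set _root_.Filter _root_.Real UpperHalfPlane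
open scoped _root_.Topology _root_.NNReal _root_.ENNReal _root_.ComplexConjugate MatrixGroups

/-! ## 1. The tent kernel and its Selberg transform -/

section Tent

variable {δ : ℝ}

/-- On `[0, δ]` the tent is `1 - u/δ`. [folklore] -/
theorem tentKernel_of_mem (hδ : 0 < δ) {u : ℝ} (hu0 : 0 ≤ u) (hu : u ≤ δ) : tentKernel δ u = 1 - u / δ := by
  unfold tentKernel
  have h2 : 0 ≤ 1 - u / δ := by rw [sub_nonneg, div_le_one hδ]; exact hu
  rw [abs_of_nonneg hu0, max_eq_right h2]

/-- `k_δ ≤ 𝟙_{[0,δ]}`. [folklore] -/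
theorem tentKernel_le_ballKernel (hδ : 0 < δ) (u : ℝ) : tentKernel δ u ≤ ballKernel δ u := by
  by_cases hu : u ≤ δ
  · rw [ballKernel_of_le hu]; exact tentKernel_le_one hδ u
  · rw [ballKernel_of_gt (not_le.mp hu), tentKernel_eq_zero hδ (not_le.mp hu).le]

/-- `∫_0^∞ k_δ = δ/2`. [folklore] -/
theorem integral_tentKernel (hδ : 0 < δ) : ∫ u in Ioi 0, tentKernel δ u = δ / 2 := by
  have h1 : ∫ u in Ioi 0, tentKernel δ u = ∫ u in Ioc 0 δ, tentKernel δ u := by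
    refine setIntegral_eq_of_subset_of_forall_sdiff_eq_zero measurableSet_Ioi Ioc_subset_Ioi_self fun u hu => ?_
    have hu' : δ < u := by
      by_contra h
      exact hu.2 ⟨hu.1, not_lt.mp h⟩
    exact tentKernel_eq_zero hδ hu'.le
  have h2 : ∫ u in Ioc 0 δ, tentKernel δ u = ∫ u in Ioc 0 δ, (1 - u / δ) :=
    setIntegral_congr_fun measurableSet_Ioc fun u hu => tentKernel_of_mem hδ hu.1.le hu.2
  rw [h1, h2, ← intervalIntegral.integral_of_le hδ.le, intervalIntegral.integral_sub intervalIntegrable_const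
    (intervalIntegral.intervalIntegrable_id.div_const _), intervalIntegral.integral_const,
    intervalIntegral.integral_div, integral_id]
  simp only [sub_zero, smul_eq_mul, mul_one, ne_eq, OfNat.ofNat_ne_zero, not_false_eq_true, zero_pow]
  field_simp
  ring

/-- `∫_ℍ k_δ(u(z, w)) dμ(w) = 2πδ`. [cite: Iwaniec2002, proof of Prop. 7.2, PDF p. 73] -/
theorem integral_tentKernel_pointPairInv (hδ : 0 < δ) (z : ℍ) :
    ∫ w : ℍ, tentKernel δ (pointPairInv z w) = 2 * π * δ := by
  rw [integral_kernel_eq_real (isTestKernel_tentKernel hδ), integral_tentKernel hδ]; ring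

/-- **`πδ ≤ |h_δ(t)|` for `|s| · 32√δ ≤ 1`** (`s = ½ + it`), the tent-kernel version of Iwaniec's
"`2πδ < |h(t)|` if `|s| ≤ (8√δ)⁻¹`": on the support `u(i, z) ≤ δ` one has `|y^s - 1| ≤ ½`, so
`|h(t) - ∫ k_δ dμ| ≤ ½ ∫ k_δ dμ` with `∫ k_δ dμ = 2πδ`. [cite: Iwaniec2002, proof of Prop. 7.2, PDF p. 73] -/
theorem norm_selbergTransform_tentKernel_ge (hδ : 0 < δ) (hδ' : δ ≤ 1 / 64) (t : ℂ)
    (hs : ‖(1 / 2 : ℂ) + Complex.I * t‖ * (32 * Real.sqrt δ) ≤ 1) :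
    π * δ ≤ ‖selbergTransform (tentKernel δ) t‖ := by
  set s : ℂ := (1 / 2 : ℂ) + Complex.I * t with hsdef
  have hk := isTestKernel_tentKernel hδ
  have h1 : selbergTransform (tentKernel δ) t =
      ∫ w : ℍ, (tentKernel δ (pointPairInv UpperHalfPlane.I w) : ℂ) * ((w.im : ℝ) : ℂ) ^ s :=
    selbergTransform_eq_integral hk t
  have h2 : ∫ w : ℍ, (tentKernel δ (pointPairInv UpperHalfPlane.I w) : ℂ) = ((2 * π * δ : ℝ) : ℂ) := by
    rw [integral_kernel_eq hk UpperHalfPlane.I, integral_tentKernel hδ]; push_cast; ring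
  have hint1 : Integrable fun w : ℍ => (tentKernel δ (pointPairInv UpperHalfPlane.I w) : ℂ) * ((w.im : ℝ) : ℂ) ^ s :=
    integrable_kernel_mul_of_continuous hk (continuous_im_cpow s) UpperHalfPlane.I
  have hint2 : Integrable fun w : ℍ => (tentKernel δ (pointPairInv UpperHalfPlane.I w) : ℂ) := by
    have := integrable_kernel_mul_of_continuous hk (continuous_const (y := (1 : ℂ))) UpperHalfPlane.I
    simpa using this
  have hdiff : selbergTransform (tentKernel δ) t - ((2 * π * δ : ℝ) : ℂ) =
      ∫ w : ℍ, (tentKernel δ (pointPairInv UpperHalfPlane.I w) : ℂ) * (((w.im : ℝ) : ℂ) ^ s - 1) := by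
    rw [h1, ← h2, ← integral_sub hint1 hint2]
    congr 1 with w; ring
  have hpt : ∀ w : ℍ, ‖(tentKernel δ (pointPairInv UpperHalfPlane.I w) : ℂ) * (((w.im : ℝ) : ℂ) ^ s - 1)‖ ≤
      (1 / 2) * tentKernel δ (pointPairInv UpperHalfPlane.I w) := by
    intro w
    by_cases hw : pointPairInv UpperHalfPlane.I w ≤ δ
    · rw [norm_mul, Complex.norm_real, Real.norm_eq_abs, abs_of_nonneg (tentKernel_nonneg _ _), mul_comm]
      refine mul_le_mul_of_nonneg_right ?_ (tentKernel_nonneg _ _)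
      have hy := abs_im_sub_one_le hδ.le (hδ'.trans (by norm_num)) hw
      have hη2 : 4 * Real.sqrt δ ≤ 1 / 2 := by
        have : Real.sqrt δ ≤ Real.sqrt (1 / 64) := Real.sqrt_le_sqrt hδ'
        rw [show (1 / 64 : ℝ) = (1 / 8) ^ 2 by norm_num, Real.sqrt_sq (by norm_num)] at this
        linarith
      have hsη : ‖s‖ * (4 * Real.sqrt δ) ≤ 1 / 4 := by nlinarith [norm_nonneg s]
      have := norm_cpow_sub_one_le w.im_pos hy hη2 hsη
      nlinarith [norm_nonneg s, Real.sqrt_nonneg δ]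
    · rw [tentKernel_eq_zero hδ (not_le.mp hw).le]
      simp
  have hbound : ‖selbergTransform (tentKernel δ) t - ((2 * π * δ : ℝ) : ℂ)‖ ≤ π * δ := by
    rw [hdiff]
    calc ‖∫ w : ℍ, (tentKernel δ (pointPairInv UpperHalfPlane.I w) : ℂ) * (((w.im : ℝ) : ℂ) ^ s - 1)‖
        ≤ ∫ w : ℍ, (1 / 2) * tentKernel δ (pointPairInv UpperHalfPlane.I w) := by
          refine norm_integral_le_of_norm_le ?_ (Eventually.of_forall hpt)
          have : Integrable fun w : ℍ => tentKernel δ (pointPairInv UpperHalfPlane.I w) := by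
            have h3 := hint2.re
            simpa using h3
          exact this.const_mul _
      _ = (1 / 2) * (2 * π * δ) := by rw [integral_const_mul, integral_tentKernel_pointPairInv hδ]
      _ = π * δ := by ring
  have hmain : ‖((2 * π * δ : ℝ) : ℂ)‖ = 2 * π * δ := by
    rw [Complex.norm_real, Real.norm_eq_abs, abs_of_pos (by positivity)]
  have := norm_sub_norm_le ((2 * π * δ : ℝ) : ℂ) (selbergTransform (tentKernel δ) t)
  rw [hmain, norm_sub_rev] at this
  linarith

/-- `h(t)` is real for real `t` (real kernel, `g` even): `h(t) = (Re h(t) : ℂ)`. [folklore] -/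
theorem selbergTransform_ofReal_eq_re (k : ℝ → ℝ) (t : ℝ) :
    selbergTransform k t = ((selbergTransform k t).re : ℂ) := by
  have h := conj_selbergTransform k (t : ℂ)
  rw [Complex.conj_ofReal, selbergTransform_neg] at h
  exact (Complex.conj_eq_iff_re.mp h).symm

/-- **`π²δ² ≤ h_δ(t)²` for real `|t| ≤ T`, `δ = 4^{-7} T⁻²`-small**: precisely, for real `t` with
`‖½ + it‖ · 32√δ ≤ 1`, `(π δ)² ≤ (Re h_δ(t))²` and `h_δ(t) = Re h_δ(t)`. [cite: Iwaniec2002, proof of Prop. 7.2, PDF p. 73] -/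
theorem sq_selbergTransform_tentKernel_ge (hδ : 0 < δ) (hδ' : δ ≤ 1 / 64) (t : ℝ)
    (hs : ‖(1 / 2 : ℂ) + Complex.I * t‖ * (32 * Real.sqrt δ) ≤ 1) :
    (π * δ) ^ 2 ≤ (selbergTransform (tentKernel δ) t).re ^ 2 := by
  have h1 := norm_selbergTransform_tentKernel_ge hδ hδ' t hs
  have h2 : ‖selbergTransform (tentKernel δ) t‖ = |(selbergTransform (tentKernel δ) t).re| := by
    conv_lhs => rw [selbergTransform_ofReal_eq_re]
    rw [Complex.norm_real, Real.norm_eq_abs]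
  rw [h2] at h1
  calc (π * δ) ^ 2 ≤ |(selbergTransform (tentKernel δ) t).re| ^ 2 := pow_le_pow_left₀ (by positivity) h1 2
    _ = (selbergTransform (tentKernel δ) t).re ^ 2 := sq_abs _

/-- The smallness condition in the form used for dyadic ranges: if `0 ≤ t ≤ T`, `1 ≤ T` and
`√δ = (128 T)⁻¹` — i.e. `δ = (128 T)⁻²` — then `‖½ + it‖ · 32√δ ≤ 1`. [folklore] -/
theorem smallness_of_le {T t : ℝ} (hT : 1 ≤ T) (ht0 : 0 ≤ t) (ht : t ≤ T) :
    ‖(1 / 2 : ℂ) + Complex.I * t‖ * (32 * Real.sqrt (((128 * T) ^ 2)⁻¹)) ≤ 1 := by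
  have hsq : Real.sqrt (((128 * T) ^ 2)⁻¹) = (128 * T)⁻¹ := by
    rw [Real.sqrt_inv, Real.sqrt_sq (by positivity)]
  have hn : ‖(1 / 2 : ℂ) + Complex.I * t‖ ≤ 1 / 2 + t := by
    calc ‖(1 / 2 : ℂ) + Complex.I * t‖ ≤ ‖(1 / 2 : ℂ)‖ + ‖Complex.I * (t : ℂ)‖ := norm_add_le _ _
      _ = 1 / 2 + t := by
          rw [norm_mul, Complex.norm_I, one_mul, Complex.norm_real, Real.norm_eq_abs, abs_of_nonneg ht0]
          norm_num
  rw [hsq]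
  have hT0 : 0 < T := by linarith
  calc ‖(1 / 2 : ℂ) + Complex.I * t‖ * (32 * (128 * T)⁻¹) ≤ (1 / 2 + t) * (32 * (128 * T)⁻¹) := by
        gcongr
    _ = (1 / 2 + t) / (4 * T) := by field_simp; ring
    _ ≤ 1 := by
        rw [div_le_one (by positivity)]
        linarith

end Tent

/-! ## 2. The automorphic kernel of the tent: `0 ≤ K^{tent} ≤ K^{ball}`, `∫_F (K^{tent})² ≤ 8πδ N_δ(w)` -/

section AutKernel

variable {Γ : Subgroup (GL (Fin 2) ℝ)} {F : Set ℍ} {δ : ℝ}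
variable (hΓ : Γ ≤ (Matrix.SpecialLinearGroup.toGL : SL(2, ℝ) →* GL (Fin 2) ℝ).range)
  (hneg : (-1 : GL (Fin 2) ℝ) ∈ Γ) (hd : IsDiscreteSubgroup Γ) (hF : IsHypFundamentalDomain Γ F)

include hΓ hd in
/-- Summability of `γ ↦ k(u(γ z, w))` for a kernel vanishing beyond `M` (finite support). [folklore] -/
theorem summable_kernel_smul {k : ℝ → ℝ} {M : ℝ} (hM : ∀ u, M ≤ u → k u = 0) (z w : ℍ) :
    Summable fun γ : Γ => k (pointPairInv ((γ : GL (Fin 2) ℝ) • z) w) := by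
  classical
  have hfin := finite_hypBall hΓ hd z w M
  refine summable_of_ne_finset_zero (s := hfin.toFinset.subtype (· ∈ Γ)) fun γ hγ => ?_
  apply hM
  by_contra hlt
  apply hγ
  simp only [Finset.mem_subtype, Set.Finite.mem_toFinset]
  exact ⟨γ.2, (not_le.mp hlt).le⟩

include hΓ hd in
/-- `K^{tent}_δ(z, w) ≥ 0`. [folklore] -/
theorem automorphicKernel_tentKernel_nonneg (hδ : 0 < δ) (z w : ℍ) :
    0 ≤ automorphicKernel Γ (tentKernel δ) z w := by
  rw [← tsum_kernel_eq_automorphicKernel hΓ hd (fun u hu => tentKernel_eq_zero hδ hu) z w]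
  exact tsum_nonneg fun γ => tentKernel_nonneg δ _

include hΓ hd in
/-- `K^{tent}_δ ≤ K^{ball}_δ` pointwise. [folklore] -/
theorem automorphicKernel_tentKernel_le_ballKernel (hδ : 0 < δ) (z w : ℍ) :
    automorphicKernel Γ (tentKernel δ) z w ≤ automorphicKernel Γ (ballKernel δ) z w := by
  have hMt : ∀ u, δ + 1 ≤ u → tentKernel δ u = 0 := fun u hu => tentKernel_eq_zero hδ (by linarith)
  have hMb : ∀ u, δ + 1 ≤ u → ballKernel δ u = 0 := fun u hu => ballKernel_of_gt (by linarith)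
  rw [← tsum_kernel_eq_automorphicKernel hΓ hd hMt z w, ← tsum_kernel_eq_automorphicKernel hΓ hd hMb z w]
  exact Summable.tsum_le_tsum (fun γ => tentKernel_le_ballKernel hδ _) (summable_kernel_smul hΓ hd hMt z w)
    (summable_kernel_smul hΓ hd hMb z w)

include hΓ hd in
/-- Measurability of `z ↦ K^{tent}_δ(z, w)` (indeed continuity). [folklore] -/
theorem measurable_automorphicKernel_tentKernel (hδ : 0 < δ) (w : ℍ) :
    Measurable fun z : ℍ => automorphicKernel Γ (tentKernel δ) z w :=
  (continuous_automorphicKernel_left hΓ hd (isTestKernel_tentKernel hδ) (continuous_tentKernel hδ) w).measurable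

include hΓ hneg hd hF in
/-- **`∫_F K^{tent}_δ(z, w)² dμ(z) ≤ 2 N_δ(w) · 4πδ`**, by comparison with the ball kernel. [cite: Iwaniec2002, proof of Prop. 7.2, PDF p. 73] -/
theorem lintegral_automorphicKernel_tentKernel_sq_le (hδ : 0 < δ) (w : ℍ) :
    ∫⁻ z in F, ENNReal.ofReal ((automorphicKernel Γ (tentKernel δ) z w) ^ 2) ≤
      2 * (orbitCount Γ δ w : ℝ≥0∞) * ENNReal.ofReal (4 * π * δ) := by
  refine le_trans (lintegral_mono fun z => ENNReal.ofReal_le_ofReal ?_) (lintegral_automorphicKernel_sq_le hΓ hneg hd hF hδ.le w)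
  exact pow_le_pow_left₀ (automorphicKernel_tentKernel_nonneg hΓ hd hδ z w)
    (automorphicKernel_tentKernel_le_ballKernel hΓ hd hδ z w) 2

include hΓ hneg hd hF in
/-- `K^{tent}_δ(·, w) ∈ L²(F)` with `∫_F ‖K^{tent}_δ(z, w)‖² dμ(z) ≤ 2 N_δ(w) · 4πδ` (complex-valued form). [cite: Iwaniec2002, proof of Prop. 7.2, PDF p. 73] -/
theorem memLp_automorphicKernel_tentKernel (hδ : 0 < δ) (w : ℍ) :
    MemLp (fun z : ℍ => (automorphicKernel Γ (tentKernel δ) z w : ℂ)) 2 (volume.restrict F) ∧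
      ∫ z in F, ‖(automorphicKernel Γ (tentKernel δ) z w : ℂ)‖ ^ 2 ≤ 2 * orbitCount Γ δ w * (4 * π * δ) := by
  set K : ℍ → ℝ := fun z => automorphicKernel Γ (tentKernel δ) z w with hK
  have hKm : Measurable K := measurable_automorphicKernel_tentKernel hΓ hd hδ w
  have hK0 : ∀ z, 0 ≤ K z := fun z => automorphicKernel_tentKernel_nonneg hΓ hd hδ z w
  have hbound := lintegral_automorphicKernel_tentKernel_sq_le hΓ hneg hd hF hδ w
  have hmeas : AEStronglyMeasurable (fun z => (K z : ℂ)) (volume.restrict F) :=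
    (Complex.measurable_ofReal.comp hKm).aestronglyMeasurable
  have enorm_eq : ∀ z, ‖(K z : ℂ)‖ₑ ^ 2 = ENNReal.ofReal (K z ^ 2) := by
    intro z
    rw [← ofReal_norm, Complex.norm_real, Real.norm_eq_abs, abs_of_nonneg (hK0 z), ← ENNReal.ofReal_pow (hK0 z)]
  have hlt : ∫⁻ z in F, ‖(K z : ℂ)‖ₑ ^ 2 < ⊤ := by
    simp_rw [enorm_eq]
    refine lt_of_le_of_lt hbound ?_
    exact ENNReal.mul_lt_top (ENNReal.mul_lt_top (by simp) (by simp)) ENNReal.ofReal_lt_top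
  have hmem : MemLp (fun z => (K z : ℂ)) 2 (volume.restrict F) := by
    refine ⟨hmeas, ?_⟩
    rw [eLpNorm_eq_lintegral_rpow_enorm_toReal two_ne_zero ENNReal.ofNat_ne_top]
    simp only [ENNReal.toReal_ofNat, one_div]
    refine ENNReal.rpow_lt_top_of_nonneg (by norm_num) (ne_of_lt ?_)
    have : ∫⁻ z in F, ‖(K z : ℂ)‖ₑ ^ (2 : ℝ) = ∫⁻ z in F, ‖(K z : ℂ)‖ₑ ^ 2 := by
      refine lintegral_congr fun z => ?_
      rw [show (2 : ℝ) = (2 : ℕ) by norm_num, ENNReal.rpow_natCast]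
    rw [this]
    exact hlt
  refine ⟨hmem, ?_⟩
  -- the integral bound from the Lebesgue-integral bound
  have hint : ∫ z in F, ‖(K z : ℂ)‖ ^ 2 = (∫⁻ z in F, ENNReal.ofReal (K z ^ 2)).toReal := by
    have hm2 : AEStronglyMeasurable (fun z => ‖(K z : ℂ)‖ ^ 2) (volume.restrict F) :=
      (continuous_pow 2).comp_aestronglyMeasurable hmeas.norm
    rw [integral_eq_lintegral_of_nonneg_ae (Eventually.of_forall fun z => sq_nonneg _) hm2]
    congr 1
    refine lintegral_congr fun z => ?_
    rw [Complex.norm_real, Real.norm_eq_abs, abs_of_nonneg (hK0 z)]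
  rw [hint]
  have hne : 2 * (orbitCount Γ δ w : ℝ≥0∞) * ENNReal.ofReal (4 * π * δ) ≠ ⊤ :=
    ENNReal.mul_ne_top (ENNReal.mul_ne_top (by simp) (by simp)) ENNReal.ofReal_ne_top
  have := (ENNReal.toReal_le_toReal (ne_of_lt (lt_of_le_of_lt hbound (lt_top_iff_ne_top.mpr hne))) hne).mpr hbound
  refine this.trans (le_of_eq ?_)
  rw [ENNReal.toReal_mul, ENNReal.toReal_mul, ENNReal.toReal_ofReal (by positivity)]
  simp

end AutKernel

/-! ## 3. Local uniformity of the orbit count -/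

section OrbitCount

variable {Γ : Subgroup (GL (Fin 2) ℝ)}
variable (hΓ : Γ ≤ (Matrix.SpecialLinearGroup.toGL : SL(2, ℝ) →* GL (Fin 2) ℝ).range)
  (hd : IsDiscreteSubgroup Γ)

include hΓ hd in
/-- **The orbit count is locally bounded**: for `δ ≤ 1` and `w` in the unit ball about `w₀`,
`N_δ(w) ≤ #{γ ∈ Γ : ρ(γ w₀, w₀) ≤ 2 arsinh √8 + 2}` (triangle inequality). [folklore] -/
theorem orbitCount_le_near {δ : ℝ} (hδ : 0 ≤ δ) (hδ1 : δ ≤ 1) (w₀ : ℍ) {w : ℍ} (hw : dist w w₀ < 1) :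
    orbitCount Γ δ w ≤ (finite_dist_le hΓ hd w₀ w₀ (2 * Real.arsinh (Real.sqrt 8) + 2)).toFinset.card := by
  rw [orbitCount, hyperbolicLatticeCount, ← Set.ncard_coe_finset]
  refine Set.ncard_le_ncard ?_ (by rw [Set.Finite.coe_toFinset]; exact finite_dist_le hΓ hd w₀ w₀ _)
  rintro γ ⟨hγ, hX⟩
  rw [Set.Finite.coe_toFinset]
  refine ⟨hγ, ?_⟩
  have hu : pointPairInv (γ • w) w ≤ 8 := by nlinarith
  have h1 : dist (γ • w) w ≤ 2 * Real.arsinh (Real.sqrt 8) := dist_le_of_pointPairInv_le hu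
  obtain ⟨g, rfl⟩ := hΓ hγ
  have e : ∀ x : ℍ, (Matrix.SpecialLinearGroup.toGL g : GL (Fin 2) ℝ) • x = g • x := fun x => rfl
  rw [e] at h1 ⊢
  calc dist (g • w₀) w₀ ≤ dist (g • w₀) (g • w) + dist (g • w) w₀ := dist_triangle _ _ _
    _ ≤ dist (g • w₀) (g • w) + (dist (g • w) w + dist w w₀) := by gcongr; exact dist_triangle _ _ _
    _ = dist w₀ w + dist (g • w) w + dist w w₀ := by rw [dist_smul]; ring
    _ ≤ 2 * Real.arsinh (Real.sqrt 8) + 2 := by rw [dist_comm w₀ w]; linarith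

end OrbitCount

end Literature.NumberTheory.Automorphic

end
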